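import Summits.QuantumFields.YangMills.Theorems.DiagonalMirrorRPRWilsonDiagonalModelPinned

/-!
# Crux `WeakCouplingHypercubicLimitRP` (stmt-QuantumFields-27398), door B, R1-side, sandwich side item (iv-a):
# the VACUUM INDEX and the SLOWEST NON-VACUUM RATIO of a diagonal slice model (Defs + proofs)

Helper file (`--supports stmt-QuantumFields-27398 --as helper`) of hand `hand-10604-wilsonDiagModel-3` g0, docket director-ym g24
**O4 WORD 47 (1)/(3)** (sandwich side of the pinned two-shift probe; target of record `twoShiftProbesAt r sch hβ P :
TwoShiftProbes (wilsonDiagonalTransferModel r sch hβ)` with every field DEFINED).  This file DEFINES, for ANY `𝔪 : DiagonalSliceModel r sch`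
and every step `k`, the two spectral fields of that instance and PROVES their four structure properties for ALL `k`:

* the top modulus is attained on the positive (`U`-even) sector — this is the LANDED ✓`DiagonalSliceModel.exists_even_top`
  (`…SignTwistedCore`, interface-level, from the odd-trace positivity `trace_nonneg`; no Jentzsch — the lifted kernel `𝔟` of the model of
  record is NOT a non-negative kernel), reused here, not restated;
* `DiagonalSliceModel.topIdx 𝔪 k` — a vacuum index (`sp k (topIdx) = top k`, chosen from `exists_even_top`); `DiagonalSliceModel.slowVal 𝔪 k j` — the non-vacuum modulus
  at `j` (`sm k j` at the vacuum index, `max (sp k j) (sm k j)` elsewhere); `DiagonalSliceModel.slowRatio 𝔪 k := (⨆ j, slowVal k j) / top k` —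
  the slowest non-vacuum ratio (`= 1` for a degenerate or wrong-sign top: then the coarse-gap letter K1 fails, as it should);
* `slowRatio_nonneg`, `slowRatio_le_one`, `sm_le_slowRatio_mul_top` (ALL `j`), `sp_le_slowRatio_mul_top` (`j ≠ topIdx`) — the fields
  `r_nonneg`, `r_le_one`, `r_spec_odd`, `r_spec_even` of `TwoShiftProbes` for `r := slowRatio 𝔪`, `j₀ := topIdx 𝔪`, for every `k`;
* `exists_slowVal_eq_iSup` — the supremum is attained (a slowest mode exists);
* §2, on the model of record `WilsonDiagonal.wilsonDiagonalTransferModel r sch hβ` at an index with `side_k ≥ 3` (eigen-package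
  `slicePkgAt r sch hβ k`, `sp/sm = posPad/negPad emb κ`): `exists_vacuumEig` (an eigen-index `o` with `emb o = topIdx` and `κ o = top k`),
  `abs_kappa_le_top`, `abs_kappa_le_slowRatio_mul_top` (`emb a ≠ topIdx ⇒ |κ a| ≤ slowRatio · top`) — the readings the normalisation
  theorem (item (iv-b)) consumes.

HONEST FRAMING: definitions and elementary real analysis on the interface / the construction; nothing about Wilson's measure at weak
coupling, the letters K1/K2/R1/R2, D1′, the crux ⟨27398⟩, its heart S6i or the summit is proved; the Yang–Mills mass gap is NOT proved
here or anywhere in the tree.  No instance, no notation, `autoImplicit false`.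
-/

set_option autoImplicit false

noncomputable section

open Filter Topology
open Literature.MathematicalPhysics.QuantumLattice Literature.MathematicalPhysics.QuantumFieldTheory
open Summit.QuantumFields.YangMills.Cruxes.DiagonalMirrorRPR.ParityBridgeColdTraces

namespace Summit.QuantumFields.YangMills.Cruxes.DiagonalMirrorRPR.SignTwistedDiagonalTrace

variable {G : Type} [Group G] [TopologicalSpace G] [IsTopologicalGroup G] [CompactSpace G] [MeasurableSpace G] [BorelSpace G]
  {r : LatticeRep G} {sch : SpeciesScheme (YMSpecies G)}

/-! ## §1 Generic: vacuum index and slowest ratio of a diagonal slice model -/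

namespace DiagonalSliceModel

/-- **A vacuum index** of the slice model at step `k`: an index of the positive sector carrying the top modulus. -/
def topIdx (𝔪 : DiagonalSliceModel r sch) (k : ℕ) : ℕ := Classical.choose (𝔪.exists_even_top k)

/-- `sp k (topIdx k) = top k`. -/
theorem sp_topIdx (𝔪 : DiagonalSliceModel r sch) (k : ℕ) : 𝔪.sp k (𝔪.topIdx k) = 𝔪.top k :=
  Classical.choose_spec (𝔪.exists_even_top k)

/-- **The non-vacuum modulus at index `j`**: the wrong-sign modulus at the vacuum index, the larger of the two moduli elsewhere. -/
def slowVal (𝔪 : DiagonalSliceModel r sch) (k j : ℕ) : ℝ :=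
  if j = 𝔪.topIdx k then 𝔪.sm k j else max (𝔪.sp k j) (𝔪.sm k j)

/-- `0 ≤ slowVal k j`. -/
theorem slowVal_nonneg (𝔪 : DiagonalSliceModel r sch) (k j : ℕ) : 0 ≤ 𝔪.slowVal k j := by
  unfold slowVal
  split_ifs
  · exact 𝔪.sm_nonneg k j
  · exact (𝔪.sp_nonneg k j).trans (le_max_left _ _)

/-- `slowVal k j ≤ top k`. -/
theorem slowVal_le_top (𝔪 : DiagonalSliceModel r sch) (k j : ℕ) : 𝔪.slowVal k j ≤ 𝔪.top k := by
  unfold slowVal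
  split_ifs
  · exact 𝔪.sm_le k j
  · exact max_le (𝔪.sp_le k j) (𝔪.sm_le k j)

/-- Every wrong-sign modulus is a non-vacuum modulus: `sm k j ≤ slowVal k j`. -/
theorem sm_le_slowVal (𝔪 : DiagonalSliceModel r sch) (k j : ℕ) : 𝔪.sm k j ≤ 𝔪.slowVal k j := by
  unfold slowVal
  split_ifs
  · exact le_rfl
  · exact le_max_right _ _

/-- Off the vacuum index every positive-sector modulus is a non-vacuum modulus: `sp k j ≤ slowVal k j`. -/
theorem sp_le_slowVal (𝔪 : DiagonalSliceModel r sch) (k : ℕ) {j : ℕ} (hj : j ≠ 𝔪.topIdx k) : 𝔪.sp k j ≤ 𝔪.slowVal k j := by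
  unfold slowVal
  rw [if_neg hj]
  exact le_max_left _ _

/-- `slowVal k j ≤ sp k j + sm k j`. -/
theorem slowVal_le_add (𝔪 : DiagonalSliceModel r sch) (k j : ℕ) : 𝔪.slowVal k j ≤ 𝔪.sp k j + 𝔪.sm k j := by
  unfold slowVal
  split_ifs
  · linarith [𝔪.sp_nonneg k j]
  · exact max_le (by linarith [𝔪.sm_nonneg k j]) (by linarith [𝔪.sp_nonneg k j])

/-- The non-vacuum moduli are bounded above (by `top k`). -/
theorem bddAbove_range_slowVal (𝔪 : DiagonalSliceModel r sch) (k : ℕ) : BddAbove (Set.range (𝔪.slowVal k)) :=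
  ⟨𝔪.top k, by rintro _ ⟨j, rfl⟩; exact 𝔪.slowVal_le_top k j⟩

/-- **The slowest non-vacuum ratio** `r_k := (⨆ j, slowVal k j) / top k ∈ [0, 1]`. -/
def slowRatio (𝔪 : DiagonalSliceModel r sch) (k : ℕ) : ℝ := (⨆ j, 𝔪.slowVal k j) / 𝔪.top k

/-- `slowVal k j ≤ slowRatio k · top k`. -/
theorem slowVal_le_slowRatio_mul_top (𝔪 : DiagonalSliceModel r sch) (k j : ℕ) : 𝔪.slowVal k j ≤ 𝔪.slowRatio k * 𝔪.top k := by
  rw [slowRatio, div_mul_cancel₀ _ (𝔪.top_pos k).ne']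
  exact le_ciSup (𝔪.bddAbove_range_slowVal k) j

/-- `0 ≤ slowRatio k` (the field `r_nonneg`). -/
theorem slowRatio_nonneg (𝔪 : DiagonalSliceModel r sch) (k : ℕ) : 0 ≤ 𝔪.slowRatio k :=
  div_nonneg ((𝔪.slowVal_nonneg k 0).trans (le_ciSup (𝔪.bddAbove_range_slowVal k) 0)) (𝔪.top_pos k).le

/-- `slowRatio k ≤ 1` (the field `r_le_one`). -/
theorem slowRatio_le_one (𝔪 : DiagonalSliceModel r sch) (k : ℕ) : 𝔪.slowRatio k ≤ 1 := by
  rw [slowRatio, div_le_one (𝔪.top_pos k)]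
  exact ciSup_le fun j => 𝔪.slowVal_le_top k j

/-- **`r_spec_odd` for every `k`**: every wrong-sign modulus is `≤ slowRatio k · top k`. -/
theorem sm_le_slowRatio_mul_top (𝔪 : DiagonalSliceModel r sch) (k j : ℕ) : 𝔪.sm k j ≤ 𝔪.slowRatio k * 𝔪.top k :=
  (𝔪.sm_le_slowVal k j).trans (𝔪.slowVal_le_slowRatio_mul_top k j)

/-- **`r_spec_even` for every `k`**: off the vacuum index every positive-sector modulus is `≤ slowRatio k · top k`. -/
theorem sp_le_slowRatio_mul_top (𝔪 : DiagonalSliceModel r sch) (k : ℕ) {j : ℕ} (hj : j ≠ 𝔪.topIdx k) :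
    𝔪.sp k j ≤ 𝔪.slowRatio k * 𝔪.top k :=
  (𝔪.sp_le_slowVal k hj).trans (𝔪.slowVal_le_slowRatio_mul_top k j)

/-- The non-vacuum moduli tend to zero along the cofinite filter (square-summability of both sectors). -/
theorem tendsto_slowVal_cofinite (𝔪 : DiagonalSliceModel r sch) (k : ℕ) : Tendsto (𝔪.slowVal k) cofinite (𝓝 0) := by
  have hsq : Tendsto (fun j => 𝔪.sp k j ^ 2 + 𝔪.sm k j ^ 2) cofinite (𝓝 0) := by
    simpa using ((𝔪.summable_sp k).tendsto_cofinite_zero).add ((𝔪.summable_sm k).tendsto_cofinite_zero)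
  -- `slowVal² ≤ 2 (sp² + sm²)`
  have hbound : ∀ j, 𝔪.slowVal k j ^ 2 ≤ 2 * (𝔪.sp k j ^ 2 + 𝔪.sm k j ^ 2) := fun j => by
    have h1 := 𝔪.slowVal_le_add k j
    have h0 := 𝔪.slowVal_nonneg k j
    nlinarith [sq_nonneg (𝔪.sp k j - 𝔪.sm k j), 𝔪.sp_nonneg k j, 𝔪.sm_nonneg k j]
  have hsq2 : Tendsto (fun j => 𝔪.slowVal k j ^ 2) cofinite (𝓝 0) := by
    have h2 : Tendsto (fun j => 2 * (𝔪.sp k j ^ 2 + 𝔪.sm k j ^ 2)) cofinite (𝓝 0) := by simpa using hsq.const_mul 2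
    exact squeeze_zero (fun j => sq_nonneg _) hbound h2
  have h3 : Tendsto (fun j => Real.sqrt (𝔪.slowVal k j ^ 2)) cofinite (𝓝 (Real.sqrt 0)) :=
    (Real.continuous_sqrt.tendsto 0).comp hsq2
  rw [Real.sqrt_zero] at h3
  refine h3.congr fun j => ?_
  rw [Real.sqrt_sq (𝔪.slowVal_nonneg k j)]

/-- **A slowest mode exists**: the supremum of the non-vacuum moduli is attained. -/
theorem exists_slowVal_eq_iSup (𝔪 : DiagonalSliceModel r sch) (k : ℕ) : ∃ j, 𝔪.slowVal k j = ⨆ j, 𝔪.slowVal k j := by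
  set s : ℝ := ⨆ j, 𝔪.slowVal k j with hs
  have hle : ∀ j, 𝔪.slowVal k j ≤ s := fun j => le_ciSup (𝔪.bddAbove_range_slowVal k) j
  by_cases hs0 : s ≤ 0
  · refine ⟨0, le_antisymm (hle 0) (hs0.trans (𝔪.slowVal_nonneg k 0))⟩
  · push Not at hs0
    have hev : ∀ᶠ j in cofinite, 𝔪.slowVal k j < s / 2 :=
      (𝔪.tendsto_slowVal_cofinite k).eventually (gt_mem_nhds (by positivity))
    have hfin : Set.Finite {j | ¬ (𝔪.slowVal k j < s / 2)} := Filter.eventually_cofinite.1 hev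
    have hne : {j | ¬ (𝔪.slowVal k j < s / 2)}.Nonempty := by
      by_contra hemp
      rw [Set.not_nonempty_iff_eq_empty] at hemp
      have hall : ∀ j, 𝔪.slowVal k j < s / 2 := fun j => by
        by_contra hj
        have : j ∈ {j | ¬ (𝔪.slowVal k j < s / 2)} := hj
        rw [hemp] at this
        exact this
      have : s ≤ s / 2 := ciSup_le fun j => (hall j).le
      linarith
    obtain ⟨j₀, hj₀, hmax⟩ := Set.exists_max_image _ (𝔪.slowVal k) hfin hne
    refine ⟨j₀, le_antisymm (hle j₀) (ciSup_le fun j => ?_)⟩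
    by_cases hj : 𝔪.slowVal k j < s / 2
    · have : s / 2 ≤ 𝔪.slowVal k j₀ := not_lt.1 hj₀
      linarith
    · exact hmax j hj

/-- **A slowest index**: some `j` with `slowVal k j = slowRatio k · top k`. -/
theorem exists_slowVal_eq (𝔪 : DiagonalSliceModel r sch) (k : ℕ) : ∃ j, 𝔪.slowVal k j = 𝔪.slowRatio k * 𝔪.top k := by
  obtain ⟨j, hj⟩ := 𝔪.exists_slowVal_eq_iSup k
  refine ⟨j, ?_⟩
  rw [hj, slowRatio, div_mul_cancel₀ _ (𝔪.top_pos k).ne']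

end DiagonalSliceModel

/-! ## §2 On the model of record: eigen-side readings at an index with `side_k ≥ 3` -/

section Pinned

open WilsonDiagonal

variable (r sch)

/-- `posPad` on the range of the (injective) padding: `posPad emb κ (emb i) = max (κ i) 0`. -/
theorem posPad_apply_emb {ι : Type} {e : ι → ℕ} (he : Function.Injective e) (κ : ι → ℝ) (i : ι) :
    posPad e κ (e i) = max (κ i) 0 := by
  unfold posPad; exact he.extend_apply _ _ i

/-- `negPad` on the range of the padding: `negPad emb κ (emb i) = max (−κ i) 0`. -/
theorem negPad_apply_emb {ι : Type} {e : ι → ℕ} (he : Function.Injective e) (κ : ι → ℝ) (i : ι) :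
    negPad e κ (e i) = max (-κ i) 0 := by
  unfold negPad; exact he.extend_apply _ _ i

/-- Off the range of the padding `posPad` vanishes. -/
theorem posPad_apply_of_not_mem_range {ι : Type} (e : ι → ℕ) (κ : ι → ℝ) {j : ℕ} (hj : j ∉ Set.range e) :
    posPad e κ j = 0 := by
  unfold posPad
  rw [Function.extend_apply' _ _ _ (fun ⟨i, hi⟩ => hj ⟨i, hi⟩)]
  rfl

/-- `|κ i| = max (posPad (emb i)) (negPad (emb i))`. -/
theorem abs_eq_max_posPad_negPad {ι : Type} {e : ι → ℕ} (he : Function.Injective e) (κ : ι → ℝ) (i : ι) :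
    |κ i| = max (posPad e κ (e i)) (negPad e κ (e i)) := by
  rw [posPad_apply_emb he, negPad_apply_emb he]
  rcases le_total 0 (κ i) with h | h
  · rw [abs_of_nonneg h, max_eq_left h, max_eq_right (by linarith : -κ i ≤ 0), max_eq_left h]
  · rw [abs_of_nonpos h, max_eq_right h, max_eq_left (by linarith : 0 ≤ -κ i), max_eq_right (by linarith : 0 ≤ -κ i)]

/-- ★ **A vacuum eigen-index**: at an index with `side_k ≥ 3` there is an eigen-index `o` of `slicePkgAt r sch hβ k` padded to the vacuum
index `topIdx`, and its eigenvalue IS the top modulus: `κ o = top k` (positive). -/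
theorem exists_vacuumEig (hβ : ∀ k, 0 ≤ sch.β k) (k : ℕ) (h3 : 3 ≤ sch.side k) :
    ∃ o : (slicePkgAt r sch hβ k).s, (slicePkgAt r sch hβ k).emb o = (wilsonDiagonalTransferModel r sch hβ).topIdx k ∧
      (slicePkgAt r sch hβ k).κ o = (wilsonDiagonalTransferModel r sch hβ).top k := by
  have htop := (wilsonDiagonalTransferModel r sch hβ).sp_topIdx k
  rw [wilsonDiagonalTransferModel_sp r sch hβ k h3] at htop
  -- the vacuum index is in the range of the padding (off-range values vanish, `top > 0`)
  have hmem : (wilsonDiagonalTransferModel r sch hβ).topIdx k ∈ Set.range (slicePkgAt r sch hβ k).emb := by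
    by_contra hnot
    rw [posPad_apply_of_not_mem_range _ _ hnot] at htop
    exact absurd htop (ne_of_lt ((wilsonDiagonalTransferModel r sch hβ).top_pos k))
  obtain ⟨o, ho⟩ := hmem
  refine ⟨o, ho, ?_⟩
  rw [← ho, posPad_apply_emb (slicePkgAt r sch hβ k).emb_injective] at htop
  -- `max (κ o) 0 = top > 0` forces `κ o = top`
  have hpos : 0 < max ((slicePkgAt r sch hβ k).κ o) 0 := by
    rw [htop]; exact (wilsonDiagonalTransferModel r sch hβ).top_pos k
  have hko : max ((slicePkgAt r sch hβ k).κ o) 0 = (slicePkgAt r sch hβ k).κ o := by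
    refine max_eq_left (le_of_lt ?_)
    by_contra hneg
    rw [max_eq_right (not_lt.1 hneg)] at hpos
    exact lt_irrefl _ hpos
  rw [hko] at htop
  exact htop

/-- Every eigenvalue modulus is `≤ top k`. -/
theorem abs_kappa_le_top (hβ : ∀ k, 0 ≤ sch.β k) (k : ℕ) (h3 : 3 ≤ sch.side k) (a : (slicePkgAt r sch hβ k).s) :
    |(slicePkgAt r sch hβ k).κ a| ≤ (wilsonDiagonalTransferModel r sch hβ).top k := by
  rw [abs_eq_max_posPad_negPad (slicePkgAt r sch hβ k).emb_injective,
    ← wilsonDiagonalTransferModel_sp r sch hβ k h3, ← wilsonDiagonalTransferModel_sm r sch hβ k h3]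
  exact max_le ((wilsonDiagonalTransferModel r sch hβ).sp_le k _) ((wilsonDiagonalTransferModel r sch hβ).sm_le k _)

/-- ★ **Every non-vacuum eigenvalue modulus is `≤ slowRatio k · top k`** (eigen-indices padded off the vacuum index). -/
theorem abs_kappa_le_slowRatio_mul_top (hβ : ∀ k, 0 ≤ sch.β k) (k : ℕ) (h3 : 3 ≤ sch.side k) (a : (slicePkgAt r sch hβ k).s)
    (ha : (slicePkgAt r sch hβ k).emb a ≠ (wilsonDiagonalTransferModel r sch hβ).topIdx k) :
    |(slicePkgAt r sch hβ k).κ a| ≤ (wilsonDiagonalTransferModel r sch hβ).slowRatio k * (wilsonDiagonalTransferModel r sch hβ).top k := by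
  rw [abs_eq_max_posPad_negPad (slicePkgAt r sch hβ k).emb_injective,
    ← wilsonDiagonalTransferModel_sp r sch hβ k h3, ← wilsonDiagonalTransferModel_sm r sch hβ k h3]
  exact max_le ((wilsonDiagonalTransferModel r sch hβ).sp_le_slowRatio_mul_top k ha)
    ((wilsonDiagonalTransferModel r sch hβ).sm_le_slowRatio_mul_top k _)

/-- The modulus of an eigenvalue in interface terms: `|κ a| = slowVal k (emb a)` off the vacuum index. -/
theorem abs_kappa_eq_slowVal (hβ : ∀ k, 0 ≤ sch.β k) (k : ℕ) (h3 : 3 ≤ sch.side k) (a : (slicePkgAt r sch hβ k).s)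
    (ha : (slicePkgAt r sch hβ k).emb a ≠ (wilsonDiagonalTransferModel r sch hβ).topIdx k) :
    |(slicePkgAt r sch hβ k).κ a| = (wilsonDiagonalTransferModel r sch hβ).slowVal k ((slicePkgAt r sch hβ k).emb a) := by
  rw [abs_eq_max_posPad_negPad (slicePkgAt r sch hβ k).emb_injective,
    ← wilsonDiagonalTransferModel_sp r sch hβ k h3, ← wilsonDiagonalTransferModel_sm r sch hβ k h3,
    DiagonalSliceModel.slowVal, if_neg ha]

end Pinned

end Summit.QuantumFields.YangMills.Cruxes.DiagonalMirrorRPR.SignTwistedDiagonalTrace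

end
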